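import Literature.Analysis.FluidPDE.Tao2016AveragedNS.SplitDelayCircuitShadowing
import HarnessLib

/-!
# Tao 2016, §5.5 with the squared modes doubled, III: the amplifier channel of the asymmetry is
# pure damping while the clock mode is non-negative

T. Tao, *Finite time blowup for an averaged three-dimensional Navier–Stokes equation*, J. Amer.
Math. Soc. **29** (2016) 601–674 = arXiv:1402.0290v3, §5.3 (the amplifier gate), §5.5 (5.5) and the
proof of Theorem 5.3, p. 29: "`b(t) = εt + O(K⁻²⁰ε)` for `t ∈ [0,t_c]`" and "`b(t) ≳ ε` for
`t ∈ [t_c, 2]`" — the clock mode `b` is NON-NEGATIVE throughout the epoch [`Tao2016AveragedNS`];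
T. H. Gronwall's inequality in the form of Mathlib's `le_gronwallBound_of_liminf_deriv_right_le`
[`HairerNorsettWanner1993`, §I.10].

HONEST FRAMING (cell harvest/h2-tao-ladder, rung 1 of a ladder of MODEL equations; RUNG1-HANDOFF h4,
crux K-iv, referee cycle 4 item r2′ "an n₀-free bound on every channel"): finite-dimensional ODE
estimate for the square-free nine-mode variant `splitDelayCircuit` of Tao's toy circuit (5.5).
Nothing here is the §6 induction, nothing certifies the rung, nothing concerns Navier–Stokes.

## What is proved

The antisymmetric amplifier coordinate `Y_c = (c′ - c″)/√2` of the split circuit obeys EXACTLY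
`∂Y_c = -ε⁻¹K¹⁰ b Y_c` (`asymPart_splitDelayCircuit`, component `1` of `asymField`): it is decoupled
from the other asymmetries and DAMPED whenever the clock mode `b ≥ 0`. Along a `δ`-pseudo-orbit the
forcing of this scalar equation is at most `√2δ`. Hence (`IsPseudoOrbit.asym_c_sq_le_gronwallBound`):
if `b ≥ -β` on the window (any `β`; `β = 0` is Tao's regime), then for every `λ > 0` and `t ∈ [0,T]`

  `Y_c(t)² ≤ gronwallBound (Y_c(0)²) (2ε⁻¹K¹⁰β + λ) (2δ²/λ) t`,

i.e. with `β = 0` (Tao's regime, `b ≥ 0` on the whole epoch): `Y_c(t)² ≤ e^{λt}Y_c(0)² + (2δ²/λ²)(e^{λt} - 1)`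
for any `λ > 0` — NO amplification by the huge coupling `ε⁻¹K¹⁰` ("channel (A) is pure damping while
`b > 0`", KIV-YRECAST §2 / ATTEMPT-p1g2 §2, here kernel-checked at the circuit level; the tree's
generic Grönwall bound `IsPseudoOrbit.asymPart_le_gronwallBound` would instead pay `e^{C_L√2R·T}`).
The elementary inequality `2ye ≤ λy² + e²/λ` trades the linear forcing for the free rate `λ`.
-/

noncomputable section

open Set Metric Filter
open scoped NNReal Topology

namespace Literature.Analysis.FluidPDE.Tao2016AveragedNS

/-- The amplifier asymmetry equation is scalar: component `1` of `asymField` is `-ε⁻¹K¹⁰·b·Y_c`.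
[cite: Tao2016AveragedNS, §5.3 (amp)] -/
theorem asymField_apply_one (K ε : ℝ) (S : Fin 5 → ℝ) (Y : Fin 4 → ℝ) :
    asymField K ε S Y 1 = -(ε⁻¹ * K ^ 10 * S 1 * Y 1) := by
  simp [asymField]

/-- `2ye ≤ λy² + e²/λ` for `λ > 0`. [folklore] -/
private theorem two_mul_mul_le_of_pos {lam : ℝ} (hlam : 0 < lam) (y e : ℝ) :
    2 * y * e ≤ lam * y ^ 2 + e ^ 2 / lam := by
  rw [← sub_nonneg]
  have h : lam * y ^ 2 + e ^ 2 / lam - 2 * y * e = (lam * y - e) ^ 2 / lam := by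
    field_simp
    ring
  rw [h]
  positivity

/-- **The amplifier channel of the asymmetry is pure damping while the clock is non-negative
(PROVED, one epoch, circuit level).** Let `X` be a `δ`-pseudo-orbit of the split circuit on `[0,T]`
(sup-ball `R`), and suppose the clock mode satisfies `b(t) = symPart (X t) 1 ≥ -β` on `[0,T)`.
Then for every `λ > 0` and `t ∈ [0,T]`,
`(asymPart (X t) 1)² ≤ gronwallBound ((asymPart (X 0) 1)²) (2ε⁻¹K¹⁰β + λ) (2δ²/λ) t` — in Tao's
regime `β = 0` the amplifier coupling `ε⁻¹K¹⁰` does not amplify `Y_c` at all; only the forcing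
`√2δ` accumulates. [cite: Tao2016AveragedNS, Theorem 5.3 proof p. 29] -/
theorem IsPseudoOrbit.asym_c_sq_le_gronwallBound {K ε δ T β lam : ℝ} {R : ℝ≥0} {X : ℝ → Fin 9 → ℝ}
    (hX : IsPseudoOrbit (splitDelayCircuit K ε) δ R T X) (hε : 0 < ε)
    (hlam : 0 < lam) (hb : ∀ t ∈ Ico 0 T, -β ≤ symPart (X t) 1) {t : ℝ} (ht : t ∈ Icc 0 T) :
    asymPart (X t) 1 ^ 2 ≤
      gronwallBound (asymPart (X 0) 1 ^ 2) (2 * (ε⁻¹ * K ^ 10) * β + lam) (2 * δ ^ 2 / lam) t := by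
  choose! V hV hVδ using hX.defect
  -- the scalar coordinate `y = Y_c` and its right derivative
  set y : ℝ → ℝ := fun τ => asymPart (X τ) 1 with hy
  have hy' : ∀ τ ∈ Ico 0 T, HasDerivWithinAt y (asymPart (V τ) 1) (Ici τ) τ := fun τ hτ =>
    hasDerivWithinAt_pi.1 ((asymPartL.hasFDerivAt (x := X τ)).comp_hasDerivWithinAt τ (hV τ hτ)) 1
  have hyc : ContinuousOn y (Icc 0 T) :=
    (continuous_apply 1).comp_continuousOn (asymPartL.continuous.comp_continuousOn hX.continuousOn)
  -- f = y², with right derivative 2 y y'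
  have hf' : ∀ τ ∈ Ico 0 T,
      HasDerivWithinAt (fun s => y s * y s) (asymPart (V τ) 1 * y τ + y τ * asymPart (V τ) 1)
        (Ici τ) τ := fun τ hτ => (hy' τ hτ).mul (hy' τ hτ)
  have hmain := le_gronwallBound_of_liminf_deriv_right_le (f := fun s => y s * y s)
    (f' := fun τ => asymPart (V τ) 1 * y τ + y τ * asymPart (V τ) 1) (a := 0) (b := T)
    (δ := asymPart (X 0) 1 ^ 2) (K := 2 * (ε⁻¹ * K ^ 10) * β + lam) (ε := 2 * δ ^ 2 / lam)
    (hyc.mul hyc) (fun τ hτ r hr => (hf' τ hτ).liminf_right_slope_le hr) (by simp [hy, sq]) ?_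
  · have := hmain t ht
    simpa [hy, sq] using this
  -- the differential inequality `(y²)' ≤ (2gβ + λ) y² + 2δ²/λ`
  intro τ hτ
  have hg : 0 ≤ ε⁻¹ * K ^ 10 := by positivity
  -- decomposition of the velocity: y' = -g b y + e, |e| ≤ √2 δ
  set e : ℝ := asymPart (V τ - splitDelayCircuit K ε (X τ)) 1 with he
  have hdec : asymPart (V τ) 1 = -(ε⁻¹ * K ^ 10 * symPart (X τ) 1 * y τ) + e := by
    have h1 : asymPart (V τ) = asymPart (V τ - splitDelayCircuit K ε (X τ)) +
        asymField K ε (symPart (X τ)) (asymPart (X τ)) := by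
      rw [asymPart_sub, asymPart_splitDelayCircuit]; abel
    have h2 := congrFun h1 1
    simp only [Pi.add_apply, asymField_apply_one] at h2
    rw [h2, he, hy]
    ring
  have hδ0 : 0 ≤ δ := (norm_nonneg _).trans (hVδ τ hτ)
  have he_abs : |e| ≤ Real.sqrt 2 * δ := by
    have h1 : |e| ≤ ‖asymPart (V τ - splitDelayCircuit K ε (X τ))‖ := by
      simpa [Real.norm_eq_abs] using norm_le_pi_norm (asymPart (V τ - splitDelayCircuit K ε (X τ))) 1
    exact h1.trans ((norm_asymPart_le _).trans
      (mul_le_mul_of_nonneg_left (hVδ τ hτ) (Real.sqrt_nonneg _)))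
  have he_sq : e ^ 2 ≤ 2 * δ ^ 2 := by
    have h1 : e ^ 2 = |e| ^ 2 := (sq_abs e).symm
    have h2 : |e| ^ 2 ≤ (Real.sqrt 2 * δ) ^ 2 := pow_le_pow_left₀ (abs_nonneg _) he_abs 2
    have h3 : (Real.sqrt 2 * δ) ^ 2 = 2 * δ ^ 2 := by
      rw [mul_pow, Real.sq_sqrt (by norm_num)]
    linarith
  -- the damping term: -2 g b y² ≤ 2 g β y²
  have hdamp : -(2 * (ε⁻¹ * K ^ 10) * symPart (X τ) 1 * y τ ^ 2) ≤
      2 * (ε⁻¹ * K ^ 10) * β * y τ ^ 2 := by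
    have hb' := hb τ hτ
    have hy2 : 0 ≤ y τ ^ 2 := sq_nonneg _
    nlinarith [mul_nonneg hg hy2]
  -- the forcing term: 2 y e ≤ λ y² + e²/λ ≤ λ y² + 2δ²/λ
  have hforce : 2 * y τ * e ≤ lam * y τ ^ 2 + 2 * δ ^ 2 / lam :=
    (two_mul_mul_le_of_pos hlam _ _).trans
      (add_le_add le_rfl (div_le_div_of_nonneg_right he_sq hlam.le))
  calc asymPart (V τ) 1 * y τ + y τ * asymPart (V τ) 1
      = -(2 * (ε⁻¹ * K ^ 10) * symPart (X τ) 1 * y τ ^ 2) + 2 * y τ * e := by rw [hdec]; ring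
    _ ≤ 2 * (ε⁻¹ * K ^ 10) * β * y τ ^ 2 + (lam * y τ ^ 2 + 2 * δ ^ 2 / lam) :=
        add_le_add hdamp hforce
    _ = (2 * (ε⁻¹ * K ^ 10) * β + lam) * (y τ * y τ) + 2 * δ ^ 2 / lam := by ring

/-- **Tao's regime (`b ≥ 0` on the whole epoch): no amplification of the amplifier asymmetry.**
For every `λ > 0`: `Y_c(t)² ≤ gronwallBound (Y_c(0)²) λ (2δ²/λ) t = e^{λt}Y_c(0)² + (2δ²/λ²)(e^{λt}-1)`.
[cite: Tao2016AveragedNS, Theorem 5.3 proof p. 29] -/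
theorem IsPseudoOrbit.asym_c_sq_le_of_clock_nonneg {K ε δ T lam : ℝ} {R : ℝ≥0} {X : ℝ → Fin 9 → ℝ}
    (hX : IsPseudoOrbit (splitDelayCircuit K ε) δ R T X) (hε : 0 < ε) (hlam : 0 < lam)
    (hb : ∀ t ∈ Ico 0 T, 0 ≤ symPart (X t) 1) {t : ℝ} (ht : t ∈ Icc 0 T) :
    asymPart (X t) 1 ^ 2 ≤ gronwallBound (asymPart (X 0) 1 ^ 2) lam (2 * δ ^ 2 / lam) t := by
  have h := hX.asym_c_sq_le_gronwallBound hε hlam (β := 0) (fun s hs => by simpa using hb s hs) ht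
  simpa using h

/-! ## The pump / rotor / hand-off block of the asymmetry: the rotor is neutral, the rates are `εb + ε²e^{-K¹⁰}S_c` and `K S_ã`, the slip forcing is `ε⁻²‖S‖|Y_c|` -/

/-- Component `0` of `asymField`: `∂Y_a = εbY_a + ε²e^{-K¹⁰}S_cY_a - ε⁻²S_cY_d + ε⁻²S_dY_c`.
[cite: Tao2016AveragedNS, §5.5 (5.5)] -/
theorem asymField_apply_zero (K ε : ℝ) (S : Fin 5 → ℝ) (Y : Fin 4 → ℝ) :
    asymField K ε S Y 0 = ε * S 1 * Y 0 + ε ^ 2 * Real.exp (-K ^ 10) * S 2 * Y 0 -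
      (ε ^ 2)⁻¹ * S 2 * Y 2 + (ε ^ 2)⁻¹ * S 3 * Y 1 := by
  simp [asymField]

/-- Component `2` of `asymField`: `∂Y_d = ε⁻²S_cY_a - ε⁻²S_aY_c + K S_ã Y_d`.
[cite: Tao2016AveragedNS, §5.5 (5.5)] -/
theorem asymField_apply_two (K ε : ℝ) (S : Fin 5 → ℝ) (Y : Fin 4 → ℝ) :
    asymField K ε S Y 2 = (ε ^ 2)⁻¹ * S 2 * Y 0 - (ε ^ 2)⁻¹ * S 0 * Y 1 + K * S 4 * Y 2 := by
  simp [asymField]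

/-- **The `(Y_a, Y_d)` block along a pseudo-orbit: the rotor is NEUTRAL, the growth rates are the pump
rate `εb + ε²e^{-K¹⁰}S_c` and the hand-off rate `K S_ã`, and the phase slip enters only as the
forcing `ε⁻²‖S‖|Y_c|` (PROVED, one epoch, circuit level).** Let `X` be a `δ`-pseudo-orbit of the split
circuit on `[0,T]` in the sup-ball `R`; suppose on `[0,T)` the pump rate `ε·b + ε²e^{-K¹⁰}·S_c ≤ M`, the
hand-off rate `K·S_ã ≤ M`, and the amplifier asymmetry `|Y_c| ≤ η_c` (e.g. from
`asym_c_sq_le_gronwallBound`). Then for every `λ > 0` and `t ∈ [0,T]`,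
`Y_a(t)² + Y_d(t)² ≤ gronwallBound (Y_a(0)² + Y_d(0)²) (2M + λ) (2G²/λ) t` with
`G = √2δ + ε⁻²·√2R·η_c`: in `∂(Y_a² + Y_d²)` the rotor's rotation terms `∓ε⁻²S_cY_aY_d` cancel, so the
huge coupling `ε⁻²` never appears as a RATE — only multiplying the (damped) `Y_c`. In Tao's regime
`M ≍ K` (the loaded next input `S_ã ≈ 1` during the drain; the pump rate is `O(ε²)`): the block is
amplified by `e^{(2K+λ)T}` per epoch, independently of the shell index.
[cite: Tao2016AveragedNS, Theorem 5.3 proof pp. 29–30] -/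
theorem IsPseudoOrbit.asym_ad_sq_le_gronwallBound {K ε δ T M ηc lam : ℝ} {R : ℝ≥0}
    {X : ℝ → Fin 9 → ℝ} (hX : IsPseudoOrbit (splitDelayCircuit K ε) δ R T X) (hε : 0 < ε)
    (hlam : 0 < lam)
    (hM0 : ∀ t ∈ Ico 0 T,
      ε * symPart (X t) 1 + ε ^ 2 * Real.exp (-K ^ 10) * symPart (X t) 2 ≤ M)
    (hM2 : ∀ t ∈ Ico 0 T, K * symPart (X t) 4 ≤ M)
    (hc : ∀ t ∈ Ico 0 T, |asymPart (X t) 1| ≤ ηc) {t : ℝ} (ht : t ∈ Icc 0 T) :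
    asymPart (X t) 0 ^ 2 + asymPart (X t) 2 ^ 2 ≤
      gronwallBound (asymPart (X 0) 0 ^ 2 + asymPart (X 0) 2 ^ 2) (2 * M + lam)
        (2 * (Real.sqrt 2 * δ + (ε ^ 2)⁻¹ * (Real.sqrt 2 * R) * ηc) ^ 2 / lam) t := by
  choose! V hV hVδ using hX.defect
  set G : ℝ := Real.sqrt 2 * δ + (ε ^ 2)⁻¹ * (Real.sqrt 2 * R) * ηc with hG
  -- the two scalar coordinates and their right derivatives
  set ya : ℝ → ℝ := fun τ => asymPart (X τ) 0 with hya
  set yd : ℝ → ℝ := fun τ => asymPart (X τ) 2 with hyd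
  have hder : ∀ τ ∈ Ico 0 T, HasDerivWithinAt (fun s => asymPart (X s)) (asymPart (V τ)) (Ici τ) τ :=
    fun τ hτ => (asymPartL.hasFDerivAt (x := X τ)).comp_hasDerivWithinAt τ (hV τ hτ)
  have hya' : ∀ τ ∈ Ico 0 T, HasDerivWithinAt ya (asymPart (V τ) 0) (Ici τ) τ := fun τ hτ =>
    hasDerivWithinAt_pi.1 (hder τ hτ) 0
  have hyd' : ∀ τ ∈ Ico 0 T, HasDerivWithinAt yd (asymPart (V τ) 2) (Ici τ) τ := fun τ hτ =>
    hasDerivWithinAt_pi.1 (hder τ hτ) 2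
  have hcont : ContinuousOn (fun s => asymPart (X s)) (Icc 0 T) :=
    asymPartL.continuous.comp_continuousOn hX.continuousOn
  have hyac : ContinuousOn ya (Icc 0 T) := (continuous_apply 0).comp_continuousOn hcont
  have hydc : ContinuousOn yd (Icc 0 T) := (continuous_apply 2).comp_continuousOn hcont
  -- f = ya² + yd²
  have hf' : ∀ τ ∈ Ico 0 T, HasDerivWithinAt (fun s => ya s * ya s + yd s * yd s)
      ((asymPart (V τ) 0 * ya τ + ya τ * asymPart (V τ) 0) +
        (asymPart (V τ) 2 * yd τ + yd τ * asymPart (V τ) 2)) (Ici τ) τ := fun τ hτ =>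
    ((hya' τ hτ).mul (hya' τ hτ)).add ((hyd' τ hτ).mul (hyd' τ hτ))
  have hmain := le_gronwallBound_of_liminf_deriv_right_le
    (f := fun s => ya s * ya s + yd s * yd s)
    (f' := fun τ => (asymPart (V τ) 0 * ya τ + ya τ * asymPart (V τ) 0) +
      (asymPart (V τ) 2 * yd τ + yd τ * asymPart (V τ) 2)) (a := 0) (b := T)
    (δ := asymPart (X 0) 0 ^ 2 + asymPart (X 0) 2 ^ 2) (K := 2 * M + lam) (ε := 2 * G ^ 2 / lam)
    ((hyac.mul hyac).add (hydc.mul hydc)) (fun τ hτ r hr => (hf' τ hτ).liminf_right_slope_le hr)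
    (by simp [hya, hyd, sq]) ?_
  · have := hmain t ht
    simpa [hya, hyd, sq] using this
  intro τ hτ
  -- notation for the symmetric state and the exact decomposition of the velocities
  set S : Fin 5 → ℝ := symPart (X τ) with hS
  set e : Fin 4 → ℝ := asymPart (V τ - splitDelayCircuit K ε (X τ)) with he
  have hdecv : asymPart (V τ) = e + asymField K ε S (asymPart (X τ)) := by
    rw [he, hS, asymPart_sub, asymPart_splitDelayCircuit]; abel
  have hda : asymPart (V τ) 0 = e 0 + (ε * S 1 * ya τ + ε ^ 2 * Real.exp (-K ^ 10) * S 2 * ya τ -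
      (ε ^ 2)⁻¹ * S 2 * yd τ + (ε ^ 2)⁻¹ * S 3 * asymPart (X τ) 1) := by
    have h2 := congrFun hdecv 0
    simp only [Pi.add_apply, asymField_apply_zero] at h2
    rw [h2]
  have hdd : asymPart (V τ) 2 = e 2 + ((ε ^ 2)⁻¹ * S 2 * ya τ - (ε ^ 2)⁻¹ * S 0 * asymPart (X τ) 1 +
      K * S 4 * yd τ) := by
    have h2 := congrFun hdecv 2
    simp only [Pi.add_apply, asymField_apply_two] at h2
    rw [h2]
  -- sizes: |e i| ≤ √2δ, |S i| ≤ √2R, |Y_c| ≤ ηc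
  have hδ0 : 0 ≤ δ := (norm_nonneg _).trans (hVδ τ hτ)
  have he_i : ∀ i, |e i| ≤ Real.sqrt 2 * δ := fun i => by
    have h1 : |e i| ≤ ‖e‖ := by simpa [Real.norm_eq_abs] using norm_le_pi_norm e i
    exact h1.trans ((norm_asymPart_le _).trans
      (mul_le_mul_of_nonneg_left (hVδ τ hτ) (Real.sqrt_nonneg _)))
  have hS_i : ∀ i, |S i| ≤ Real.sqrt 2 * R := fun i => by
    have h1 : |S i| ≤ ‖S‖ := by simpa [Real.norm_eq_abs] using norm_le_pi_norm S i
    exact h1.trans ((norm_symPart_le _).trans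
      (mul_le_mul_of_nonneg_left (hX.norm_le τ hτ) (Real.sqrt_nonneg _)))
  have hr0 : 0 ≤ (ε ^ 2)⁻¹ := by positivity
  have hSR : 0 ≤ Real.sqrt 2 * (R : ℝ) := by positivity
  have hYc := hc τ hτ
  -- the two forcing terms g_a = e 0 + ε⁻²S_3Y_c, g_d = e 2 - ε⁻²S_0Y_c are bounded by G
  have hslip : ∀ i, |(ε ^ 2)⁻¹ * S i * asymPart (X τ) 1| ≤ (ε ^ 2)⁻¹ * (Real.sqrt 2 * R) * ηc :=
    fun i => by
      rw [abs_mul, abs_mul, abs_of_nonneg hr0]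
      exact mul_le_mul (mul_le_mul_of_nonneg_left (hS_i i) hr0) hYc (abs_nonneg _)
        (mul_nonneg hr0 hSR)
  have hga : |e 0 + (ε ^ 2)⁻¹ * S 3 * asymPart (X τ) 1| ≤ G :=
    (abs_add_le _ _).trans (add_le_add (he_i 0) (hslip 3))
  have hgd : |e 2 - (ε ^ 2)⁻¹ * S 0 * asymPart (X τ) 1| ≤ G := by
    refine (abs_sub _ _).trans (add_le_add (he_i 2) (hslip 0))
  have hG0 : 0 ≤ G := (abs_nonneg _).trans hga
  have hga2 : (e 0 + (ε ^ 2)⁻¹ * S 3 * asymPart (X τ) 1) ^ 2 ≤ G ^ 2 := by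
    have := pow_le_pow_left₀ (abs_nonneg _) hga 2; rwa [sq_abs] at this
  have hgd2 : (e 2 - (ε ^ 2)⁻¹ * S 0 * asymPart (X τ) 1) ^ 2 ≤ G ^ 2 := by
    have := pow_le_pow_left₀ (abs_nonneg _) hgd 2; rwa [sq_abs] at this
  -- rates
  have hrate_a : 2 * (ε * S 1 + ε ^ 2 * Real.exp (-K ^ 10) * S 2) * ya τ ^ 2 ≤ 2 * M * ya τ ^ 2 := by
    have := hM0 τ hτ
    nlinarith [sq_nonneg (ya τ)]
  have hrate_d : 2 * (K * S 4) * yd τ ^ 2 ≤ 2 * M * yd τ ^ 2 := by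
    have := hM2 τ hτ
    nlinarith [sq_nonneg (yd τ)]
  -- forcing via 2yg ≤ λy² + g²/λ
  have hfa : 2 * ya τ * (e 0 + (ε ^ 2)⁻¹ * S 3 * asymPart (X τ) 1) ≤ lam * ya τ ^ 2 + G ^ 2 / lam :=
    (two_mul_mul_le_of_pos hlam _ _).trans (add_le_add le_rfl (div_le_div_of_nonneg_right hga2 hlam.le))
  have hfd : 2 * yd τ * (e 2 - (ε ^ 2)⁻¹ * S 0 * asymPart (X τ) 1) ≤ lam * yd τ ^ 2 + G ^ 2 / lam :=
    (two_mul_mul_le_of_pos hlam _ _).trans (add_le_add le_rfl (div_le_div_of_nonneg_right hgd2 hlam.le))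
  calc (asymPart (V τ) 0 * ya τ + ya τ * asymPart (V τ) 0) +
        (asymPart (V τ) 2 * yd τ + yd τ * asymPart (V τ) 2)
      = 2 * (ε * S 1 + ε ^ 2 * Real.exp (-K ^ 10) * S 2) * ya τ ^ 2 + 2 * (K * S 4) * yd τ ^ 2 +
          2 * ya τ * (e 0 + (ε ^ 2)⁻¹ * S 3 * asymPart (X τ) 1) +
          2 * yd τ * (e 2 - (ε ^ 2)⁻¹ * S 0 * asymPart (X τ) 1) := by
        rw [hda, hdd]; ring
    _ ≤ 2 * M * ya τ ^ 2 + 2 * M * yd τ ^ 2 + (lam * ya τ ^ 2 + G ^ 2 / lam) +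
          (lam * yd τ ^ 2 + G ^ 2 / lam) :=
        add_le_add (add_le_add (add_le_add hrate_a hrate_d) hfa) hfd
    _ = (2 * M + lam) * (ya τ * ya τ + yd τ * yd τ) + 2 * G ^ 2 / lam := by ring

/-! ## The born-symmetric output row and the assembled one-epoch asymmetry budget in Tao's regime -/

/-- **The next input is born symmetric up to the forcing**: `∂Y_ã = 0` exactly (`asymField` row `3`),
so along a `δ`-pseudo-orbit `|Y_ã(t)| ≤ |Y_ã(0)| + √2δ·t`. [cite: Tao2016AveragedNS, §5.5 (5.5)] -/
theorem IsPseudoOrbit.asym_out_abs_le {K ε δ T : ℝ} {R : ℝ≥0} {X : ℝ → Fin 9 → ℝ}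
    (hX : IsPseudoOrbit (splitDelayCircuit K ε) δ R T X) {t : ℝ} (ht : t ∈ Icc 0 T) :
    |asymPart (X t) 3| ≤ |asymPart (X 0) 3| + Real.sqrt 2 * δ * t := by
  choose! V hV hVδ using hX.defect
  have hder : ∀ τ ∈ Ico 0 T, HasDerivWithinAt (fun s => asymPart (X s) 3) (asymPart (V τ) 3) (Ici τ) τ :=
    fun τ hτ => hasDerivWithinAt_pi.1
      ((asymPartL.hasFDerivAt (x := X τ)).comp_hasDerivWithinAt τ (hV τ hτ)) 3
  have hcont : ContinuousOn (fun s => asymPart (X s) 3) (Icc 0 T) :=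
    (continuous_apply 3).comp_continuousOn (asymPartL.continuous.comp_continuousOn hX.continuousOn)
  have key := norm_le_gronwallBound_of_norm_deriv_right_le (f := fun s => asymPart (X s) 3)
    (f' := fun τ => asymPart (V τ) 3) (δ := |asymPart (X 0) 3|) (K := 0) (ε := Real.sqrt 2 * δ)
    (a := 0) (b := T) hcont hder (by simp [Real.norm_eq_abs]) ?_
  · have h := key t ht
    simpa [Real.norm_eq_abs, gronwallBound_K0] using h
  · intro τ hτ
    have hdec : asymPart (V τ) 3 = asymPart (V τ - splitDelayCircuit K ε (X τ)) 3 := by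
      have h1 : asymPart (V τ) = asymPart (V τ - splitDelayCircuit K ε (X τ)) +
          asymField K ε (symPart (X τ)) (asymPart (X τ)) := by
        rw [asymPart_sub, asymPart_splitDelayCircuit]; abel
      have h2 := congrFun h1 3
      simpa [asymField] using h2
    rw [hdec, zero_mul, zero_add, Real.norm_eq_abs]
    have h1 : |asymPart (V τ - splitDelayCircuit K ε (X τ)) 3| ≤
        ‖asymPart (V τ - splitDelayCircuit K ε (X τ))‖ := by
      simpa [Real.norm_eq_abs] using norm_le_pi_norm (asymPart (V τ - splitDelayCircuit K ε (X τ))) 3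
    exact h1.trans ((norm_asymPart_le _).trans
      (mul_le_mul_of_nonneg_left (hVδ τ hτ) (Real.sqrt_nonneg _)))

/-- **The one-epoch asymmetry budget in Tao's regime, assembled (PROVED).** Along a `δ`-pseudo-orbit
of the split circuit on `[0,T]` (sup-ball `R`) with NON-NEGATIVE clock `b ≥ 0` on `[0,T)` (Thm 5.3's
proof: `b = εt` then `b ≳ ε`), pump rate `ε·b + ε²e^{-K¹⁰}·S_c ≤ M` and hand-off rate `K·S_ã ≤ M`:
for every `λ > 0`, with the amplifier asymmetry envelope
`η_c := √(gronwallBound (Y_c(0)²) λ (2δ²/λ) T)` (channel (A), no `ε⁻¹K¹⁰`), the pump/rotor/hand-off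
block obeys `Y_a(t)² + Y_d(t)² ≤ gronwallBound (Y_a(0)² + Y_d(0)²) (2M + λ) (2G²/λ) t`,
`G = √2δ + ε⁻²·√2R·η_c`, for all `t ∈ [0,T]` — rates `{λ, 2M}`, forcings `{√2δ, ε⁻²√2R·η_c}`, all
independent of any shell index. (`Y_ã`: `asym_out_abs_le`.) [cite: Tao2016AveragedNS, Theorem 5.3 proof pp. 29–30] -/
theorem IsPseudoOrbit.asym_ad_sq_le_of_clock_nonneg {K ε δ T M lam : ℝ} {R : ℝ≥0}
    {X : ℝ → Fin 9 → ℝ} (hX : IsPseudoOrbit (splitDelayCircuit K ε) δ R T X) (hε : 0 < ε)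
    (hlam : 0 < lam) (hb : ∀ t ∈ Ico 0 T, 0 ≤ symPart (X t) 1)
    (hM0 : ∀ t ∈ Ico 0 T,
      ε * symPart (X t) 1 + ε ^ 2 * Real.exp (-K ^ 10) * symPart (X t) 2 ≤ M)
    (hM2 : ∀ t ∈ Ico 0 T, K * symPart (X t) 4 ≤ M) {t : ℝ} (ht : t ∈ Icc 0 T) :
    asymPart (X t) 0 ^ 2 + asymPart (X t) 2 ^ 2 ≤
      gronwallBound (asymPart (X 0) 0 ^ 2 + asymPart (X 0) 2 ^ 2) (2 * M + lam)
        (2 * (Real.sqrt 2 * δ + (ε ^ 2)⁻¹ * (Real.sqrt 2 * R) *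
          Real.sqrt (gronwallBound (asymPart (X 0) 1 ^ 2) lam (2 * δ ^ 2 / lam) T)) ^ 2 / lam) t := by
  refine hX.asym_ad_sq_le_gronwallBound hε hlam hM0 hM2 (fun s hs => ?_) ht
  have hsq := hX.asym_c_sq_le_of_clock_nonneg hε hlam hb (t := s) ⟨hs.1, hs.2.le⟩
  have hmono := gronwallBound_mono (δ := asymPart (X 0) 1 ^ 2) (K := lam) (ε := 2 * δ ^ 2 / lam)
    (sq_nonneg _) (by positivity) hlam.le hs.2.le
  rw [← Real.sqrt_sq_eq_abs]
  exact Real.sqrt_le_sqrt (hsq.trans hmono)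

/-! ## Theorem 5.3 for the doubled circuit with the structured asymmetry budget (one epoch) -/

/-- The explicit one-epoch asymmetry envelope in Tao's regime: the maximum of the pump/rotor/hand-off
block envelope `√(gronwallBound (Y_a(0)²+Y_d(0)²) (2M+λ) (2G²/λ) T)`, the amplifier envelope
`√(gronwallBound (Y_c(0)²) λ (2δ²/λ) T)` and the output row `|Y_ã(0)| + √2δT`, with
`G = √2δ + ε⁻²√2R·√(gronwallBound (Y_c(0)²) λ (2δ²/λ) T)`. [cite: Tao2016AveragedNS, Theorem 5.3] -/
def asymEnvelope (ε δ M lam T : ℝ) (R : ℝ≥0) (Y₀ : Fin 4 → ℝ) : ℝ :=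
  max (max
    (Real.sqrt (gronwallBound (Y₀ 0 ^ 2 + Y₀ 2 ^ 2) (2 * M + lam)
      (2 * (Real.sqrt 2 * δ + (ε ^ 2)⁻¹ * (Real.sqrt 2 * R) *
        Real.sqrt (gronwallBound (Y₀ 1 ^ 2) lam (2 * δ ^ 2 / lam) T)) ^ 2 / lam) T))
    (Real.sqrt (gronwallBound (Y₀ 1 ^ 2) lam (2 * δ ^ 2 / lam) T)))
    (|Y₀ 3| + Real.sqrt 2 * δ * T)

/-- **In Tao's regime the asymmetry of a pseudo-orbit stays below the explicit envelope** on the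
whole window: `‖asymPart (X t)‖ ≤ asymEnvelope ε δ M λ T R (asymPart (X 0))` for `t ∈ [0,T)`,
given clock `b ≥ 0`, pump rate `≤ M`, hand-off rate `≤ M`, `M ≥ 0`. [cite: Tao2016AveragedNS, Theorem 5.3 proof pp. 29–30] -/
theorem IsPseudoOrbit.norm_asymPart_le_asymEnvelope {K ε δ T M lam : ℝ} {R : ℝ≥0}
    {X : ℝ → Fin 9 → ℝ} (hX : IsPseudoOrbit (splitDelayCircuit K ε) δ R T X) (hε : 0 < ε)
    (hlam : 0 < lam) (hM : 0 ≤ M) (hb : ∀ t ∈ Ico 0 T, 0 ≤ symPart (X t) 1)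
    (hM0 : ∀ t ∈ Ico 0 T,
      ε * symPart (X t) 1 + ε ^ 2 * Real.exp (-K ^ 10) * symPart (X t) 2 ≤ M)
    (hM2 : ∀ t ∈ Ico 0 T, K * symPart (X t) 4 ≤ M) {t : ℝ} (ht : t ∈ Ico 0 T) :
    ‖asymPart (X t)‖ ≤ asymEnvelope ε δ M lam T R (asymPart (X 0)) := by
  have ht' : t ∈ Icc 0 T := ⟨ht.1, ht.2.le⟩
  have hδ0 : 0 ≤ δ := by
    obtain ⟨V, -, hVδ⟩ := hX.defect t ht
    exact (norm_nonneg _).trans hVδ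
  have hTt : t ≤ T := ht.2.le
  have hT0 : 0 ≤ T := ht.1.trans hTt
  -- the three envelopes at time t, then monotonicity in t
  have had := hX.asym_ad_sq_le_of_clock_nonneg hε hlam hb hM0 hM2 ht'
  have hc := hX.asym_c_sq_le_of_clock_nonneg hε hlam hb ht'
  have hout := hX.asym_out_abs_le ht'
  have hmono_ad := gronwallBound_mono
    (δ := asymPart (X 0) 0 ^ 2 + asymPart (X 0) 2 ^ 2) (K := 2 * M + lam)
    (ε := 2 * (Real.sqrt 2 * δ + (ε ^ 2)⁻¹ * (Real.sqrt 2 * R) *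
      Real.sqrt (gronwallBound (asymPart (X 0) 1 ^ 2) lam (2 * δ ^ 2 / lam) T)) ^ 2 / lam)
    (by positivity) (by positivity) (by positivity) hTt
  have hmono_c := gronwallBound_mono (δ := asymPart (X 0) 1 ^ 2) (K := lam)
    (ε := 2 * δ ^ 2 / lam) (sq_nonneg _) (by positivity) hlam.le hTt
  have henv0 : 0 ≤ asymEnvelope ε δ M lam T R (asymPart (X 0)) :=
    (le_max_right _ _).trans' (by positivity)
  refine (pi_norm_le_iff_of_nonneg henv0).2 fun i => ?_
  rw [Real.norm_eq_abs]
  fin_cases i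
  · refine le_trans ?_ ((le_max_left _ _).trans (le_max_left _ _))
    rw [← Real.sqrt_sq_eq_abs]
    exact Real.sqrt_le_sqrt ((le_add_of_nonneg_right (sq_nonneg _)).trans (had.trans hmono_ad))
  · refine le_trans ?_ ((le_max_right _ _).trans (le_max_left _ _))
    rw [← Real.sqrt_sq_eq_abs]
    exact Real.sqrt_le_sqrt (hc.trans hmono_c)
  · refine le_trans ?_ ((le_max_left _ _).trans (le_max_left _ _))
    rw [← Real.sqrt_sq_eq_abs]
    exact Real.sqrt_le_sqrt ((le_add_of_nonneg_left (sq_nonneg _)).trans (had.trans hmono_ad))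
  · refine le_trans ?_ (le_max_right _ _)
    exact hout.trans (add_le_add le_rfl (mul_le_mul_of_nonneg_left hTt (by positivity)))

/-- **Theorem 5.3 for the doubled circuit, one epoch, with the structured asymmetry budget (PROVED).**
With the constants `C, K₀, ε₁(K)` of the tree's Theorem 5.3: for `K ≥ K₀`, `0 < ε ≤ ε₁(K)`, every
`δ`-pseudo-orbit `X` of the split circuit on `[0,T]` in the sup-ball `R` (`R′ ≥ max(1, √2R)`) whose
symmetric part starts `δ₀`-close to (5.6), with NON-NEGATIVE clock, pump rate `≤ M` and hand-off rate
`≤ M` (`M ≥ 0`), makes the delayed abrupt energy transition in `(S_a,b,S_c,S_d,S_ã)` up to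
`C K⁻¹⁰ + gronwallBound δ₀ (delayLipschitz K ε R′) (√2δ + C_Q η²) t`, where
`η = asymEnvelope ε δ M λ T R (asymPart (X 0))` is EXPLICIT in the initial asymmetry, the defect
`δ`, the rates `{λ, 2M}` and the window — no `ε⁻¹K¹⁰`, no `ε⁻²` as a rate, nothing shell-dependent.
[cite: Tao2016AveragedNS, Theorem 5.3] -/
theorem splitPseudoOrbit_delayedAbruptTransition_of_clock_nonneg :
    ∃ C : ℝ, 0 < C ∧ ∃ K₀ : ℝ, 0 < K₀ ∧ ∀ K : ℝ, K₀ ≤ K → ∃ ε₁ : ℝ, 0 < ε₁ ∧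
      ∀ ε : ℝ, 0 < ε → ε ≤ ε₁ → ∀ (R R' : ℝ≥0), 1 ≤ R' → Real.sqrt 2 * (R : ℝ) ≤ R' →
        ∀ (δ δ₀ M lam T : ℝ) (X : ℝ → Fin 9 → ℝ), 0 < lam → 0 ≤ M →
        IsPseudoOrbit (splitDelayCircuit K ε) δ R T X → ‖symPart (X 0) - delayInit‖ ≤ δ₀ →
        (∀ t ∈ Ico 0 T, 0 ≤ symPart (X t) 1) →
        (∀ t ∈ Ico 0 T, ε * symPart (X t) 1 + ε ^ 2 * Real.exp (-K ^ 10) * symPart (X t) 2 ≤ M) →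
        (∀ t ∈ Ico 0 T, K * symPart (X t) 4 ≤ M) →
        ∃ tc : ℝ, |tc - Real.sqrt 2| ≤ C / Real.sqrt K ∧
          (∀ t ∈ Icc 0 T, t ≤ tc - 1 / Real.sqrt K →
            |symPart (X t) 0 - 1| ≤ C / K ^ 10 + gronwallBound δ₀ (delayLipschitz K ε R')
                (Real.sqrt 2 * δ + splitCorrectionConst K ε *
                  asymEnvelope ε δ M lam T R (asymPart (X 0)) ^ 2) t ∧
            ∀ i : Fin 5, i ≠ 0 →
              |symPart (X t) i| ≤ C / K ^ 10 + gronwallBound δ₀ (delayLipschitz K ε R')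
                (Real.sqrt 2 * δ + splitCorrectionConst K ε *
                  asymEnvelope ε δ M lam T R (asymPart (X 0)) ^ 2) t) ∧
          (∀ t ∈ Icc 0 T, tc + 1 / Real.sqrt K ≤ t →
            |symPart (X t) 4 - 1| ≤ C / K ^ 10 + gronwallBound δ₀ (delayLipschitz K ε R')
                (Real.sqrt 2 * δ + splitCorrectionConst K ε *
                  asymEnvelope ε δ M lam T R (asymPart (X 0)) ^ 2) t ∧
            ∀ i : Fin 5, i ≠ 4 →
              |symPart (X t) i| ≤ C / K ^ 10 + gronwallBound δ₀ (delayLipschitz K ε R')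
                (Real.sqrt 2 * δ + splitCorrectionConst K ε *
                  asymEnvelope ε δ M lam T R (asymPart (X 0)) ^ 2) t) := by
  obtain ⟨C, hC, K₀, hK₀, h⟩ := splitPseudoOrbit_delayedAbruptTransition
  refine ⟨C, hC, K₀, hK₀, fun K hK => ?_⟩
  obtain ⟨ε₁, hε₁, hε⟩ := h K hK
  refine ⟨ε₁, hε₁, fun ε hε0 hεle R R' hR' hRR' δ δ₀ M lam T X hlam hM hX h0 hb hM0 hM2 => ?_⟩
  exact hε ε hε0 hεle R R' hR' hRR' δ δ₀ _ T X hX h0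
    (fun t ht => hX.norm_asymPart_le_asymEnvelope hε0 hlam hM hb hM0 hM2 ht)

end Literature.Analysis.FluidPDE.Tao2016AveragedNS
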